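import Summits.Ventures.LatticeQCDFlow.Scaling.StartStateDomination

/-!
HONEST FRAMING: exact (Metropolis-corrected) sampling algorithms for lattice gauge theory; figures
of merit are autocorrelation/cost numbers at stated couplings and volumes; no continuum-physics
claim.

# StepChainResolvent — THE RESOLVENT KERNEL `U = (1−σ)(I − σA)⁻¹` OF A REVERSIBLE KERNEL `A`: UNIQUE, STOCHASTIC, A TWO-SIDED INVERSE, REVERSIBLE, `π`-STATIONARY, AND THE FORM FACTS
# `‖Ug‖²_π ≤ ⟨g,Ug⟩_π`, CAUCHY–SCHWARZ FOR `⟨·,U·⟩_π` (THE FIRST FILE OF THE CYCLE → STEP TRANSFER OF OPEN-MATH ITEM 1 (i) (b); lean-2 GEN-38, ours)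

Venture-side (OURS).  Cell `lqcd-flow` (pub-lqcd), unit `pub-lqcd-lean-2-g38`, 2026-08-30.  Chapter X (item 1 (i) (b): from refresh cycles to steps), file 1.  The step chain of the lumped star is
`S = σA + (1−σ)B` (`A` one swap attempt, `B` the redraw, both reversible w.r.t. `π_S`, `B² = B`) and the refresh-cycle chain of chapters V–W is `C = UB` with the RESOLVENT KERNEL
`U = (1−σ)Σ_jσ^jA^j`, i.e. `(I − σA)U = (1−σ)I` (OPEN-MATH GEN-38 addendum, route (α)).  This file collects what the transfer needs about `U`, for any kernel `A ≥ 0` with unit row sums,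
reversible w.r.t. a positive `π`, and any `σ ∈ [0,1)`, with `U` given by its hypothesis-equation `U(x,y) = (1−σ)δ_{xy} + σΣ_zA(x,z)U(z,y)`.  Hypothesis-equations, no definitions.

## What is proved

* `kernel_max_principle` (`h = σAh ⇒ h = 0`), `resolventKernel_unique`, `resolventKernel_left_of_right` (row form ⇒ column form), `resolventKernel_rowsum` (`U𝟙 = 𝟙`), `resolventKernel_right` (`U = (1−σ)I + σUA`), `resolventKernel_reversible`
  (`π(x)U(x,y) = π(y)U(y,x)`), `resolventKernel_stationary` (`πU = π`), `resolventKernel_apply` (`(I−σA)(Ug) = (1−σ)g`), `resolventKernel_form_ge_normSq` (`‖Ug‖²_π ≤ ⟨g,Ug⟩_π`, from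
  the Dirichlet form of `A`, file W20), `resolventKernel_form_symm`, `resolventKernel_cauchySchwarz`.

Reading (no numerics implied): standard resolvent algebra in `ℓ²(π)`.  Literature grade (cell rule): OWN, elementary; nothing cited as a fact; no new bib keys.
-/

open Finset

namespace Summit.Ventures.LatticeQCDFlow.Scaling

section Resolvent
variable {X : Type*} [Fintype X] [DecidableEq X]
variable {π : X → ℝ} {A U : X → X → ℝ} {σ : ℝ}

omit [DecidableEq X] in
/-- **Maximum principle:** if `A ≥ 0` has unit row sums, `0 ≤ σ < 1` and `h = σAh`, then `h = 0`. [ours] -/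
theorem kernel_max_principle (hA0 : ∀ x y, 0 ≤ A x y) (hA1 : ∀ x, ∑ y, A x y = 1) (hσ0 : 0 ≤ σ) (hσ1 : σ < 1)
    {h : X → ℝ} (hh : ∀ x, h x = σ * ∑ y, A x y * h y) : ∀ x, h x = 0 := by
  classical
  by_cases hne : (univ : Finset X).Nonempty
  · obtain ⟨x₀, -, hx₀⟩ := exists_max_image univ (fun x => |h x|) hne
    have hM : |h x₀| ≤ σ * |h x₀| := by
      calc |h x₀| = |σ * ∑ y, A x₀ y * h y| := by rw [← hh x₀]
        _ = σ * |∑ y, A x₀ y * h y| := by rw [abs_mul, abs_of_nonneg hσ0]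
        _ ≤ σ * ∑ y, A x₀ y * |h y| := by
            refine mul_le_mul_of_nonneg_left ((abs_sum_le_sum_abs _ _).trans (le_of_eq (sum_congr rfl fun y _ => ?_))) hσ0
            rw [abs_mul, abs_of_nonneg (hA0 x₀ y)]
        _ ≤ σ * ∑ y, A x₀ y * |h x₀| := mul_le_mul_of_nonneg_left (sum_le_sum fun y _ => mul_le_mul_of_nonneg_left (hx₀ y (mem_univ y)) (hA0 x₀ y)) hσ0
        _ = σ * |h x₀| := by rw [← sum_mul, hA1, one_mul]
    have h0 : |h x₀| = 0 := by nlinarith [abs_nonneg (h x₀)]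
    intro x
    have := hx₀ x (mem_univ x)
    rw [h0] at this
    exact abs_eq_zero.mp (le_antisymm this (abs_nonneg _))
  · intro x; exact absurd ⟨x, mem_univ x⟩ hne

omit [DecidableEq X] in
/-- **Uniqueness** of solutions of `u = c + σAu`. [ours] -/
theorem resolventKernel_unique (hA0 : ∀ x y, 0 ≤ A x y) (hA1 : ∀ x, ∑ y, A x y = 1) (hσ0 : 0 ≤ σ) (hσ1 : σ < 1) {c : X → ℝ} {u v : X → ℝ}
    (hu : ∀ x, u x = c x + σ * ∑ y, A x y * u y) (hv : ∀ x, v x = c x + σ * ∑ y, A x y * v y) : ∀ x, u x = v x := by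
  have h := kernel_max_principle hA0 hA1 hσ0 hσ1 (h := fun x => u x - v x) (fun x => by
    rw [hu x, hv x]
    have : ∑ y, A x y * (u y - v y) = ∑ y, A x y * u y - ∑ y, A x y * v y := by rw [← sum_sub_distrib]; exact sum_congr rfl fun y _ => by ring
    rw [this]; ring)
  intro x; have := h x; linarith

/-- **Unit row sums:** `Σ_y U(x,y) = 1`. [ours] -/
theorem resolventKernel_rowsum (hA0 : ∀ x y, 0 ≤ A x y) (hA1 : ∀ x, ∑ y, A x y = 1) (hσ0 : 0 ≤ σ) (hσ1 : σ < 1)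
    (hU : ∀ x y, U x y = (1 - σ) * (if x = y then 1 else 0) + σ * ∑ z, A x z * U z y) : ∀ x, ∑ y, U x y = 1 := by
  have hs : ∀ x, (∑ y, U x y) = (1 - σ) + σ * ∑ z, A x z * ∑ y, U z y := by
    intro x
    calc ∑ y, U x y = ∑ y, ((1 - σ) * (if x = y then 1 else 0) + σ * ∑ z, A x z * U z y) := sum_congr rfl fun y _ => hU x y
      _ = (1 - σ) * ∑ y, (if x = y then (1 : ℝ) else 0) + σ * ∑ y, ∑ z, A x z * U z y := by rw [sum_add_distrib, mul_sum, mul_sum]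
      _ = (1 - σ) + σ * ∑ z, A x z * ∑ y, U z y := by
          congr 1
          · simp
          · rw [sum_comm]; congr 1; exact sum_congr rfl fun z _ => by rw [mul_sum]
  have h1 : ∀ x, (1 : ℝ) = (1 - σ) + σ * ∑ z, A x z * 1 := fun x => by rw [sum_congr rfl fun z _ => mul_one (A x z), hA1]; ring
  exact resolventKernel_unique hA0 hA1 hσ0 hσ1 (c := fun _ => 1 - σ) hs h1

/-- **The right-inverse identity:** `U = (1−σ)I + σUA` (so `U(I − σA) = (1−σ)I = (I − σA)U`). [ours] -/
theorem resolventKernel_right (hA0 : ∀ x y, 0 ≤ A x y) (hA1 : ∀ x, ∑ y, A x y = 1) (hσ0 : 0 ≤ σ) (hσ1 : σ < 1)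
    (hU : ∀ x y, U x y = (1 - σ) * (if x = y then 1 else 0) + σ * ∑ z, A x z * U z y) :
    ∀ x y, U x y = (1 - σ) * (if x = y then 1 else 0) + σ * ∑ z, U x z * A z y := by
  intro x y
  -- both `x ↦ U(x,y)` and `x ↦ W(x,y) := (1−σ)δ_{xy} + σΣ_z U(x,z)A(z,y)` solve the column equation with source `(1−σ)δ_y`
  refine resolventKernel_unique hA0 hA1 hσ0 hσ1 (c := fun x0 => (1 - σ) * (if x0 = y then (1 : ℝ) else 0))
    (u := fun x0 => U x0 y) (v := fun x0 => (1 - σ) * (if x0 = y then (1 : ℝ) else 0) + σ * ∑ z, U x0 z * A z y) (fun x0 => hU x0 y) (fun x0 => ?_) x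
  -- the column equation for `W`: expand `U(x0,z)` inside `Σ_z U(x0,z)A(z,y)`
  have e1 : ∑ z, U x0 z * A z y = (1 - σ) * A x0 y + σ * ∑ w, A x0 w * ∑ z, U w z * A z y := by
    calc ∑ z, U x0 z * A z y = ∑ z, (((1 - σ) * (if x0 = z then 1 else 0) + σ * ∑ w, A x0 w * U w z) * A z y) := sum_congr rfl fun z _ => by rw [hU x0 z]
      _ = (1 - σ) * ∑ z, (if x0 = z then A z y else 0) + σ * ∑ z, ∑ w, A x0 w * U w z * A z y := by
          rw [show (∑ z, (((1 - σ) * (if x0 = z then 1 else 0) + σ * ∑ w, A x0 w * U w z) * A z y))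
              = ∑ z, ((1 - σ) * (if x0 = z then A z y else 0) + σ * ∑ w, A x0 w * U w z * A z y) from
              sum_congr rfl fun z _ => by rw [add_mul, mul_assoc σ, sum_mul]; split_ifs <;> ring]
          rw [sum_add_distrib, mul_sum, mul_sum]
      _ = (1 - σ) * A x0 y + σ * ∑ w, A x0 w * ∑ z, U w z * A z y := by
          congr 1
          · simp
          · rw [sum_comm]; congr 1; exact sum_congr rfl fun w _ => by rw [mul_sum]; exact sum_congr rfl fun z _ => by ring
  have e2 : ∑ w, A x0 w * ((1 - σ) * (if w = y then (1 : ℝ) else 0) + σ * ∑ z, U w z * A z y)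
      = (1 - σ) * A x0 y + σ * ∑ w, A x0 w * ∑ z, U w z * A z y := by
    rw [show (∑ w, A x0 w * ((1 - σ) * (if w = y then (1 : ℝ) else 0) + σ * ∑ z, U w z * A z y))
        = ∑ w, ((1 - σ) * (if w = y then A x0 w else 0) + σ * (A x0 w * ∑ z, U w z * A z y)) from
        sum_congr rfl fun w _ => by split_ifs <;> ring]
    rw [sum_add_distrib, ← mul_sum, ← mul_sum]
    congr 1
    simp
  rw [e1, e2]

/-- **Reversibility:** `π(x)U(x,y) = π(y)U(y,x)` when `A` is reversible w.r.t. `π > 0`. [ours] -/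
theorem resolventKernel_reversible (hπ : ∀ x, 0 < π x) (hA0 : ∀ x y, 0 ≤ A x y) (hA1 : ∀ x, ∑ y, A x y = 1) (hrev : ∀ x y, π x * A x y = π y * A y x)
    (hσ0 : 0 ≤ σ) (hσ1 : σ < 1) (hU : ∀ x y, U x y = (1 - σ) * (if x = y then 1 else 0) + σ * ∑ z, A x z * U z y) :
    ∀ x y, π x * U x y = π y * U y x := by
  have hrow := resolventKernel_right hA0 hA1 hσ0 hσ1 hU
  -- `x ↦ π(y)U(y,x)/π(x)` solves the column equation of `x ↦ U(x,y)`
  have key : ∀ y x, π y * U y x / π x = (1 - σ) * (if x = y then 1 else 0) + σ * ∑ z, A x z * (π y * U y z / π z) := by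
    intro y x
    have hπx := hπ x
    have e3 : ∑ z, A x z * (π y * U y z / π z) = (π y / π x) * ∑ z, U y z * A z x := by
      rw [mul_sum]
      refine sum_congr rfl fun z _ => ?_
      have hπz := hπ z
      have hzx : A z x = π x * A x z / π z := by rw [hrev x z]; field_simp
      rw [hzx]; field_simp
    rw [e3, hrow y x]
    by_cases hxy : x = y
    · subst hxy; simp only [if_true] ; field_simp
    · rw [if_neg hxy, if_neg (Ne.symm hxy)]; field_simp; ring
  intro x y
  have huniq := resolventKernel_unique hA0 hA1 hσ0 hσ1 (c := fun x0 => (1 - σ) * (if x0 = y then (1 : ℝ) else 0))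
    (u := fun x0 => U x0 y) (v := fun x0 => π y * U y x0 / π x0) (fun x0 => hU x0 y) (key y) x
  have hπx := hπ x
  rw [huniq]; field_simp

/-- **Stationarity:** `Σ_x π(x)U(x,y) = π(y)`. [ours] -/
theorem resolventKernel_stationary (hπ : ∀ x, 0 < π x) (hA0 : ∀ x y, 0 ≤ A x y) (hA1 : ∀ x, ∑ y, A x y = 1) (hrev : ∀ x y, π x * A x y = π y * A y x)
    (hσ0 : 0 ≤ σ) (hσ1 : σ < 1) (hU : ∀ x y, U x y = (1 - σ) * (if x = y then 1 else 0) + σ * ∑ z, A x z * U z y) :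
    ∀ y, ∑ x, π x * U x y = π y := by
  intro y
  rw [sum_congr rfl fun x _ => resolventKernel_reversible hπ hA0 hA1 hrev hσ0 hσ1 hU x y, ← mul_sum, resolventKernel_rowsum hA0 hA1 hσ0 hσ1 hU y, mul_one]

omit [DecidableEq X] in
/-- `(I − σA)(Ug) = (1−σ)g` for the image `(Ug)(x) = Σ_y U(x,y)g(y)`. [ours] -/
theorem resolventKernel_apply [DecidableEq X] (hU : ∀ x y, U x y = (1 - σ) * (if x = y then 1 else 0) + σ * ∑ z, A x z * U z y) (g : X → ℝ) (x : X) :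
    (∑ y, U x y * g y) - σ * ∑ z, A x z * ∑ y, U z y * g y = (1 - σ) * g x := by
  have e : ∑ y, U x y * g y = (1 - σ) * g x + σ * ∑ z, A x z * ∑ y, U z y * g y := by
    calc ∑ y, U x y * g y = ∑ y, (((1 - σ) * (if x = y then 1 else 0) + σ * ∑ z, A x z * U z y) * g y) := sum_congr rfl fun y _ => by rw [hU x y]
      _ = (1 - σ) * ∑ y, (if x = y then g y else 0) + σ * ∑ y, ∑ z, A x z * U z y * g y := by
          rw [show (∑ y, (((1 - σ) * (if x = y then 1 else 0) + σ * ∑ z, A x z * U z y) * g y))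
              = ∑ y, ((1 - σ) * (if x = y then g y else 0) + σ * ∑ z, A x z * U z y * g y) from
              sum_congr rfl fun y _ => by rw [add_mul, mul_assoc σ, sum_mul]; split_ifs <;> ring]
          rw [sum_add_distrib, mul_sum, mul_sum]
      _ = (1 - σ) * g x + σ * ∑ z, A x z * ∑ y, U z y * g y := by
          congr 1
          · simp
          · rw [sum_comm]; congr 1; exact sum_congr rfl fun z _ => by rw [mul_sum]; exact sum_congr rfl fun y _ => by ring
  rw [e]; ring

/-- **`‖Ug‖²_π ≤ ⟨g,Ug⟩_π`** (`0 ≤ U ≤ I` in `ℓ²(π)`, through the Dirichlet form of `A`). [ours] -/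
theorem resolventKernel_form_ge_normSq (hπ : ∀ x, 0 < π x) (hA0 : ∀ x y, 0 ≤ A x y) (hA1 : ∀ x, ∑ y, A x y = 1) (hrev : ∀ x y, π x * A x y = π y * A y x)
    (hσ0 : 0 ≤ σ) (hσ1 : σ < 1) (hU : ∀ x y, U x y = (1 - σ) * (if x = y then 1 else 0) + σ * ∑ z, A x z * U z y) (g : X → ℝ) :
    ∑ x, π x * (∑ y, U x y * g y) ^ 2 ≤ ∑ x, π x * g x * ∑ y, U x y * g y := by
  set w : X → ℝ := fun x => ∑ y, U x y * g y with hw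
  have h1σ : 0 < 1 - σ := by linarith
  -- `(1−σ)⟨g,w⟩ = ⟨(I−σA)w, w⟩ = ‖w‖² − σ⟨Aw,w⟩ ≥ (1−σ)‖w‖²`
  have happ : ∀ x, (1 - σ) * g x = w x - σ * ∑ z, A x z * w z := fun x => by rw [hw]; exact (resolventKernel_apply hU g x).symm
  have hD := dirichlet_form_nonneg (P := A) (m := π) (σ := 1) hrev hA0 hA1 (fun x => (hπ x).le) zero_le_one le_rfl w
  have e : (1 - σ) * ∑ x, π x * g x * w x = ∑ x, π x * w x ^ 2 - σ * ∑ x, π x * w x * ∑ z, A x z * w z := by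
    rw [mul_sum, mul_sum, ← sum_sub_distrib]
    refine sum_congr rfl fun x _ => ?_
    have := happ x
    calc (1 - σ) * (π x * g x * w x) = π x * ((1 - σ) * g x) * w x := by ring
      _ = π x * (w x - σ * ∑ z, A x z * w z) * w x := by rw [this]
      _ = π x * w x ^ 2 - σ * (π x * w x * ∑ z, A x z * w z) := by ring
  have hD' : ∑ x, π x * w x * ∑ z, A x z * w z ≤ ∑ x, π x * w x ^ 2 := by
    have : 0 ≤ ∑ x, π x * w x * (w x - 1 * ∑ z, A x z * w z) := hD
    have e2 : ∑ x, π x * w x * (w x - 1 * ∑ z, A x z * w z) = ∑ x, π x * w x ^ 2 - ∑ x, π x * w x * ∑ z, A x z * w z := by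
      rw [← sum_sub_distrib]; exact sum_congr rfl fun x _ => by ring
    linarith [e2 ▸ this]
  have hw2 : 0 ≤ ∑ x, π x * w x ^ 2 := sum_nonneg fun x _ => mul_nonneg (hπ x).le (sq_nonneg _)
  -- conclude: `(1−σ)⟨g,w⟩ ≥ ‖w‖² − σ‖w‖² = (1−σ)‖w‖²`
  have : (1 - σ) * ∑ x, π x * w x ^ 2 ≤ (1 - σ) * ∑ x, π x * g x * w x := by
    rw [e]; nlinarith [mul_le_mul_of_nonneg_left hD' hσ0]
  exact le_of_mul_le_mul_left this h1σ

/-- The form `⟨h,Ug⟩_π` is symmetric. [ours] -/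
theorem resolventKernel_form_symm (hπ : ∀ x, 0 < π x) (hA0 : ∀ x y, 0 ≤ A x y) (hA1 : ∀ x, ∑ y, A x y = 1) (hrev : ∀ x y, π x * A x y = π y * A y x)
    (hσ0 : 0 ≤ σ) (hσ1 : σ < 1) (hU : ∀ x y, U x y = (1 - σ) * (if x = y then 1 else 0) + σ * ∑ z, A x z * U z y) (g h : X → ℝ) :
    ∑ x, π x * h x * ∑ y, U x y * g y = ∑ x, π x * g x * ∑ y, U x y * h y := by
  have hrevU := resolventKernel_reversible hπ hA0 hA1 hrev hσ0 hσ1 hU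
  calc ∑ x, π x * h x * ∑ y, U x y * g y = ∑ x, ∑ y, π x * U x y * (h x * g y) := by
        refine sum_congr rfl fun x _ => ?_; rw [mul_sum]; exact sum_congr rfl fun y _ => by ring
    _ = ∑ x, ∑ y, π y * U y x * (h x * g y) := sum_congr rfl fun x _ => sum_congr rfl fun y _ => by rw [hrevU x y]
    _ = ∑ y, ∑ x, π y * U y x * (h x * g y) := sum_comm
    _ = ∑ y, π y * g y * ∑ x, U y x * h x := by
        refine sum_congr rfl fun y _ => ?_; rw [mul_sum]; exact sum_congr rfl fun x _ => by ring

/-- **Cauchy–Schwarz for the form `⟨·,U·⟩_π`:** `⟨h,Ug⟩² ≤ ⟨h,Uh⟩⟨g,Ug⟩`. [ours] -/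
theorem resolventKernel_cauchySchwarz (hπ : ∀ x, 0 < π x) (hA0 : ∀ x y, 0 ≤ A x y) (hA1 : ∀ x, ∑ y, A x y = 1) (hrev : ∀ x y, π x * A x y = π y * A y x)
    (hσ0 : 0 ≤ σ) (hσ1 : σ < 1) (hU : ∀ x y, U x y = (1 - σ) * (if x = y then 1 else 0) + σ * ∑ z, A x z * U z y) (g h : X → ℝ) :
    (∑ x, π x * h x * ∑ y, U x y * g y) ^ 2 ≤ (∑ x, π x * h x * ∑ y, U x y * h y) * (∑ x, π x * g x * ∑ y, U x y * g y) := by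
  -- the form `Q(f) = ⟨f,Uf⟩_π` is a non-negative quadratic form; expand `Q(a·h − b·g) ≥ 0`
  set Q : (X → ℝ) → (X → ℝ) → ℝ := fun f₁ f₂ => ∑ x, π x * f₁ x * ∑ y, U x y * f₂ y with hQ
  have hQnn : ∀ f : X → ℝ, 0 ≤ Q f f := fun f =>
    (sum_nonneg fun x _ => mul_nonneg (hπ x).le (sq_nonneg _)).trans (resolventKernel_form_ge_normSq hπ hA0 hA1 hrev hσ0 hσ1 hU f)
  have hsymm : Q h g = Q g h := resolventKernel_form_symm hπ hA0 hA1 hrev hσ0 hσ1 hU g h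
  -- bilinearity in the combination `a·h − b·g`
  have hexp : ∀ a b : ℝ, Q (fun x => a * h x - b * g x) (fun x => a * h x - b * g x) = a ^ 2 * Q h h - 2 * a * b * Q h g + b ^ 2 * Q g g := by
    intro a b
    have hlin : ∀ x, ∑ y, U x y * (a * h y - b * g y) = a * ∑ y, U x y * h y - b * ∑ y, U x y * g y := fun x => by
      rw [mul_sum, mul_sum, ← sum_sub_distrib]; exact sum_congr rfl fun y _ => by ring
    simp only [hQ, hlin]
    have : ∀ x, π x * (a * h x - b * g x) * (a * ∑ y, U x y * h y - b * ∑ y, U x y * g y)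
        = a ^ 2 * (π x * h x * ∑ y, U x y * h y) - a * b * (π x * h x * ∑ y, U x y * g y) - a * b * (π x * g x * ∑ y, U x y * h y)
          + b ^ 2 * (π x * g x * ∑ y, U x y * g y) := fun x => by ring
    rw [sum_congr rfl fun x _ => this x, sum_add_distrib, sum_sub_distrib, sum_sub_distrib, ← mul_sum, ← mul_sum, ← mul_sum, ← mul_sum]
    have hs' : ∑ x, π x * g x * ∑ y, U x y * h y = Q h g := hsymm.symm
    rw [hs']; simp only [hQ]; ring
  change (Q h g) ^ 2 ≤ Q h h * Q g g
  by_cases hg0 : Q g g = 0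
  · -- then `Q h g = 0`: use `a = Q h g`, `b = t` large of both signs
    have key : ∀ b : ℝ, 0 ≤ (Q h g) ^ 2 * Q h h - 2 * (Q h g) ^ 2 * b := by
      intro b
      have := hQnn (fun x => Q h g * h x - b * g x)
      rw [hexp, hg0] at this
      nlinarith [this]
    have h1 := key (Q h h + 1)
    have h2 := key (-(Q h h + 1))
    have hQhh := hQnn h
    have : (Q h g) ^ 2 = 0 := by nlinarith [sq_nonneg (Q h g)]
    rw [this, hg0, mul_zero]
  · have hgpos : 0 < Q g g := lt_of_le_of_ne (hQnn g) (Ne.symm hg0)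
    have := hQnn (fun x => Q g g * h x - Q h g * g x)
    rw [hexp] at this
    -- `0 ≤ Qgg² Qhh − 2 Qgg Qhg² + Qhg² Qgg = Qgg (Qgg Qhh − Qhg²)`
    have h3 : 0 ≤ Q g g * (Q g g * Q h h - (Q h g) ^ 2) := by nlinarith [this]
    nlinarith [(mul_nonneg_iff_of_pos_left hgpos).mp h3]

/-- **From the row form to the column form:** if `U = (1−σ)I + σUA` (row by row), then `U = (1−σ)I + σAU` (the hypothesis-equation of this file). [ours] -/
theorem resolventKernel_left_of_right (hA0 : ∀ x y, 0 ≤ A x y) (hA1 : ∀ x, ∑ y, A x y = 1) (hσ0 : 0 ≤ σ) (hσ1 : σ < 1)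
    (hUr : ∀ x y, U x y = (1 - σ) * (if x = y then 1 else 0) + σ * ∑ z, U x z * A z y) :
    ∀ x y, U x y = (1 - σ) * (if x = y then 1 else 0) + σ * ∑ z, A x z * U z y := by
  -- `W := (1−σ)I + σAU` solves the ROW equation `W = (1−σ)I + σWA`, as `U` does; uniqueness of row solutions (file W1)
  have e1 : ∀ x y, ∑ z, A x z * U z y = (1 - σ) * A x y + σ * ∑ w, (∑ z, A x z * U z w) * A w y := by
    intro x y
    calc ∑ z, A x z * U z y = ∑ z, A x z * ((1 - σ) * (if z = y then 1 else 0) + σ * ∑ w, U z w * A w y) := sum_congr rfl fun z _ => by rw [hUr z y]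
      _ = (1 - σ) * ∑ z, (if z = y then A x z else 0) + σ * ∑ z, ∑ w, A x z * (U z w * A w y) := by
          rw [show (∑ z, A x z * ((1 - σ) * (if z = y then 1 else 0) + σ * ∑ w, U z w * A w y))
              = ∑ z, ((1 - σ) * (if z = y then A x z else 0) + σ * ∑ w, A x z * (U z w * A w y)) from
              sum_congr rfl fun z _ => by rw [mul_add, mul_left_comm (A x z) σ, mul_sum univ _ (A x z)]; split_ifs <;> ring]
          rw [sum_add_distrib, mul_sum, mul_sum]
      _ = (1 - σ) * A x y + σ * ∑ w, (∑ z, A x z * U z w) * A w y := by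
          congr 1
          · simp
          · rw [sum_comm]; congr 1; exact sum_congr rfl fun w _ => by rw [sum_mul]; exact sum_congr rfl fun z _ => by ring
  have hW : ∀ x y, ((1 - σ) * (if x = y then (1:ℝ) else 0) + σ * ∑ z, A x z * U z y)
      = (1 - σ) * (if y = x then (1:ℝ) else 0) + σ * ∑ w, ((1 - σ) * (if x = w then (1:ℝ) else 0) + σ * ∑ z, A x z * U z w) * A w y := by
    intro x y
    have e2 : ∑ w, ((1 - σ) * (if x = w then (1:ℝ) else 0) + σ * ∑ z, A x z * U z w) * A w y
        = (1 - σ) * A x y + σ * ∑ w, (∑ z, A x z * U z w) * A w y := by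
      rw [show (∑ w, ((1 - σ) * (if x = w then (1:ℝ) else 0) + σ * ∑ z, A x z * U z w) * A w y)
          = ∑ w, ((1 - σ) * (if x = w then A w y else 0) + σ * ((∑ z, A x z * U z w) * A w y)) from
          sum_congr rfl fun w _ => by split_ifs <;> ring]
      rw [sum_add_distrib, ← mul_sum, ← mul_sum]
      congr 1; simp
    rw [e1, e2]
    by_cases hxy : x = y
    · subst hxy; simp
    · rw [if_neg hxy, if_neg (Ne.symm hxy)]
  intro x y
  have hrow1 : ∀ y0, U x y0 = (1 - σ) * (if y0 = x then (1:ℝ) else 0) + σ * ∑ z, U x z * A z y0 := fun y0 => by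
    rw [hUr x y0]
    by_cases h : x = y0
    · subst h; simp
    · rw [if_neg h, if_neg (Ne.symm h)]
  have huniq := geomResolvent_unique (K := A) (σ := σ) (ν := fun y0 => if y0 = x then (1:ℝ) else 0) hA0 hA1 hσ0 hσ1
    (u := fun y0 => U x y0) (u' := fun y0 => (1 - σ) * (if x = y0 then (1:ℝ) else 0) + σ * ∑ z, A x z * U z y0) hrow1 (hW x)
  exact congr_fun huniq y

end Resolvent

end Summit.Ventures.LatticeQCDFlow.Scaling
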